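import Summits.ResolutionOfSingularities.ResolutionOfSingularities.Theorems.FrobeniusLadderFInjectiveMacaulayficationHypersurfaceLocalDim
import Literature.AlgebraicGeometry.Resolution.AffineDomainEquidim
import Mathlib.RingTheory.KrullDimension.Polynomial
import Mathlib.RingTheory.Localization.AtPrime.Basic
import Mathlib.RingTheory.Localization.Away.Basic
import Mathlib.RingTheory.Localization.InvSubmonoid
import Mathlib.RingTheory.Localization.Submodule
import Mathlib.RingTheory.Algebraic.Basic
import Mathlib.Algebra.MvPolynomial.Equiv
import HarnessLib

/-!
# Dimension of `(R[1/u])[s]` at its maximal ideals, `R` an affine hypersurface domain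
# (crux `FInjectiveMacaulayfication`, line `graded-engine`, §16 helper D1)

Support file for crux stmt-ResolutionOfSingularities-15315 (`FrobeniusLadder.FInjectiveMacaulayfication`), §16 THE GRADED
ENGINE (CRUX-PLAN w45a v3, line `graded-engine`, registered stub G4 `stub_gradedChartClause`; design memo GRADED-ENGINE.md v2
step (iv), lead seat res-L1-w45a-lead-1, typed helper target D1 `dim_polynomial_away` of `GradedChartClausePlan.lean`).
[OURS · L1 W4.5a] — elementary dimension bookkeeping, not a statement of any manuscript.

Finite graded descent (`FiniteGradedDescent.stub_finiteGradedDescent`, p173797) is run on the extended Rees algebra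
`T' = L[s]`, `L = R[1/u]`, `R = k[X₁, …, Xₙ]/(f)` with `(f)` prime and `u ≠ 0`, and needs that EVERY maximal localisation of
`T'` has dimension `n`. Proof: `T'` is a domain of finite type over `k`, so it is equidimensional at closed points
(`Literature…ringKrullDim_localization_atPrime_eq_of_isMaximal`, Matsumura §5); and
`dim T' = dim L + 1 = dim R + 1 = (n − 1) + 1` (`Polynomial.ringKrullDim_of_isNoetherianRing`; localising a domain at a
non-zero element preserves the transcendence degree, hence the dimension; `HypersurfaceLocalDim.stub_hypersurfaceLocalDim`
p459362).

* `ringKrullDim_away_eq` — `dim A[1/a] = dim A` for an affine domain `A` over a field and `a ≠ 0`;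
* `ringKrullDim_hypersurface` — `dim k[X₀, …, X_m]/(f) = m` for `f ≠ 0` with `(f)` prime;
* `dim_polynomial_away` — the typed helper target D1 verbatim.

## References

* H. Matsumura, *Commutative Ring Theory*, CUP 1986, §5 Thm. 5.6 and Ex. 5.1. [Matsumura1987]; folklore.
-/

set_option linter.dupNamespace false

noncomputable section

open Polynomial Literature.AlgebraicGeometry.Resolution

namespace Summit.ResolutionOfSingularities.ResolutionOfSingularities.Theorems.FInjectiveMacaulayfication.PolynomialAwayDim

universe u

/-- **`dim A[1/a] = dim A`** for a domain `A` of finite type over a field `k` and `0 ≠ a ∈ A`: both are affine domains, and the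
transcendence degree of `A[1/a]` over `k` is that of `A` (`A[1/a]` is algebraic over `A`), so the dimension theorem
`dim = trdeg` (`exists_ringKrullDim_eq_and_trdeg_eq`) gives equality. [cite: Matsumura1987, §5 Thm. 5.6] -/
theorem ringKrullDim_away_eq (k : Type u) {A : Type u} [Field k] [CommRing A] [IsDomain A] [Algebra k A]
    [Algebra.FiniteType k A] {a : A} (ha : a ≠ 0) :
    ringKrullDim (Localization.Away a) = ringKrullDim A := by
  haveI : IsDomain (Localization.Away a) :=
    IsLocalization.isDomain_localization (powers_le_nonZeroDivisors_of_noZeroDivisors ha)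
  haveI : FaithfulSMul k A :=
    (faithfulSMul_iff_algebraMap_injective k A).mpr (algebraMap k A).injective
  haveI : FaithfulSMul A (Localization.Away a) := (faithfulSMul_iff_algebraMap_injective A _).mpr
    (IsLocalization.injective (Localization.Away a) (powers_le_nonZeroDivisors_of_noZeroDivisors ha))
  haveI : Algebra.IsAlgebraic A (Localization.Away a) :=
    IsLocalization.isAlgebraic (Localization.Away a) (Submonoid.powers a)
  obtain ⟨n₁, h₁, t₁⟩ := exists_ringKrullDim_eq_and_trdeg_eq k (Localization.Away a)
  obtain ⟨n₂, h₂, t₂⟩ := exists_ringKrullDim_eq_and_trdeg_eq k A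
  have ht : Algebra.trdeg k (Localization.Away a) = Algebra.trdeg k A := by
    rw [← trdeg_add_eq k A (A := Localization.Away a), trdeg_eq_zero (R := A) (A := Localization.Away a),
      add_zero]
  rw [t₁, t₂] at ht
  have h12 : n₁ = n₂ := by exact_mod_cast ht
  rw [h₁, h₂, h12]

/-- **`dim k[X₀, …, X_m]/(f) = m`** for `f ≠ 0` with `(f)` prime: the quotient is an affine domain, equidimensional at its
closed points (`ringKrullDim_localization_atPrime_eq_of_isMaximal`), and its local rings at maximal ideals have dimension `m`
(`HypersurfaceLocalDim.stub_hypersurfaceLocalDim`, p459362). [folklore; Matsumura §5 Ex. 5.1] -/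
theorem ringKrullDim_hypersurface (k : Type) [Field k] (m : ℕ) (f : MvPolynomial (Fin (m + 1)) k) (hf0 : f ≠ 0)
    (hfprime : (Ideal.span {f}).IsPrime) :
    ringKrullDim (MvPolynomial (Fin (m + 1)) k ⧸ Ideal.span {f}) = m := by
  haveI := hfprime
  haveI : IsDomain (MvPolynomial (Fin (m + 1)) k ⧸ Ideal.span {f}) := Ideal.Quotient.isDomain _
  obtain ⟨Q₀, hQ₀⟩ := Ideal.exists_maximal (MvPolynomial (Fin (m + 1)) k ⧸ Ideal.span {f})
  rw [← ringKrullDim_localization_atPrime_eq_of_isMaximal k Q₀]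
  exact HypersurfaceLocalDim.stub_hypersurfaceLocalDim k m f hf0 Q₀

/-- **D1 `dim_polynomial_away`** (typed helper target of the G4 assembly plan, verbatim): for `R = k[X₁, …, Xₙ]/(f)` with
`f ≠ 0`, `(f)` prime, and `0 ≠ u ∈ R`, every localisation of `T' = (R[1/u])[s]` at a maximal ideal has dimension `n`.
(`n = 0` cannot occur: a non-zero constant generates the unit ideal.) [folklore; Matsumura §5 Thm. 5.6, Ex. 5.1] -/
theorem dim_polynomial_away (k : Type) [Field k] (n : ℕ) (f : MvPolynomial (Fin n) k) (hf0 : f ≠ 0)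
    (u : MvPolynomial (Fin n) k ⧸ Ideal.span {f}) (hu : u ≠ 0) (hfprime : (Ideal.span {f}).IsPrime)
    (Q : Ideal (Polynomial (Localization.Away u))) [Q.IsMaximal] :
    ringKrullDim (Localization.AtPrime Q) = n := by
  haveI := hfprime
  cases n with
  | zero =>
    -- `k[∅] ≃ k`: the non-zero `f` is a unit, so `(f) = ⊤` is not prime
    exfalso
    have e := MvPolynomial.isEmptyAlgEquiv k (Fin 0)
    have hef : e f ≠ 0 := by
      intro h
      exact hf0 (by simpa using congrArg e.symm h)
    have hunit : IsUnit f := by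
      have h2 : IsUnit (e.symm (e f)) := (IsUnit.mk0 _ hef).map e.symm
      rwa [e.symm_apply_apply] at h2
    exact hfprime.ne_top (Ideal.span_singleton_eq_top.mpr hunit)
  | succ m =>
    haveI : IsDomain (MvPolynomial (Fin (m + 1)) k ⧸ Ideal.span {f}) := Ideal.Quotient.isDomain _
    haveI : IsDomain (Localization.Away u) :=
      IsLocalization.isDomain_localization (powers_le_nonZeroDivisors_of_noZeroDivisors hu)
    haveI : IsNoetherianRing (Localization.Away u) :=
      Algebra.FiniteType.isNoetherianRing k (Localization.Away u)
    rw [ringKrullDim_localization_atPrime_eq_of_isMaximal k Q, Polynomial.ringKrullDim_of_isNoetherianRing,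
      ringKrullDim_away_eq k hu, ringKrullDim_hypersurface k m f hf0 hfprime]
    norm_cast

end Summit.ResolutionOfSingularities.ResolutionOfSingularities.Theorems.FInjectiveMacaulayfication.PolynomialAwayDim

end
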